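/-
Copyright (c) 2026 the pub-hodgecm-mathlib formalisation cell (harness21).  Prover seat hodgecm-mathlib-K2E3-p23 (g5), HCML Track B «K2-LIT» ∕ h413
(`stmt-HodgeConjecture-24833`), line `K2_E3_EllipticInputs`, unit U12 «Characters», road «GL-[M6]-sc» (line lead K2E3-p23 (g5), dealer K2E3-plan (g3)),
MEMO «M6sc-BLUEPRINT v4» §1 (ASM): the `hball` hypothesis of ★ `nonEllEstimates_of_radius`, packaged Haar-a.e. on `G' = GL₃(F)/ϖ^ℤ`.  2026-09-04.
-/
import Summits.HodgeConjecture.HodgeConjecture.Theorems.K2E3GL3ModUniformizerNonEllBallMixed   -- ★ p858442 (this seat): both cases at an integral representative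
import Summits.HodgeConjecture.HodgeConjecture.Theorems.K2E3GL3ModUniformizerSeparableAE     -- ★ p858176 (K2E3-p14 g5): `ae_exists_mk_eq_discr_ne_zero`; brings (N0), centralizer-compact
import Summits.HodgeConjecture.HodgeConjecture.Theorems.K2E3GL3ModUniformizerFundamentalDomain -- ★ p858113 (K2E3-p03): `mk_scalar_zpow_mul`
import HarnessLib

/-!
# Road «GL-[M6]-sc», ASM brick: `hball` PACKAGED — Haar-a.e. on `G'`, off the elliptic set,
# `∫_{Ω (R x̄)} ‖θ(z · x̄ · z⁻¹)‖ dμ'(z) ≤ M_θ · (c · C(m) · 3(2(R x̄ + 12 h(x̄) + L(x̄))+1)² · ‖2‖⁻¹ q^{m+1} · q^{3h(x̄)} · |D♮(x̄)|^{-1∕2})` (Harish-Chandra 1970, VII §3)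

Cell `pub/hodgecm-mathlib` (D-0151), Track B «K2-LIT», crux H413 = `stmt-HodgeConjecture-24833`, route of record `HCCMUnconditional`.  Lane
`--supports stmt-HodgeConjecture-24833 --as helper`; THEOREMS ONLY (no `def`, no `instance`, no `notation`, no named-fact hypothesis, no `sorry`); count-neutral.

This is the `hball` input of ★ ASM-core `K2E3NonEllEstimatesOfRadius.nonEllEstimates_of_radius` in the road's currency, for ANY radius `R : G' → ℕ`, with the
weight written in three user-supplied coordinates of `x̄ ∈ G'` (all quantified, no `def`): a height `h : G' → ℕ` with `x̄ ∈ Ω (h x̄)`, the normalised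
discriminant `δ : G' → ℝ≥0`, `δ(mk g) = ‖disc χ_g‖ ∕ ‖det g‖²` (scale invariant), and a depth `L : G' → ℕ` with `q^{-L x̄} ≤ δ x̄` wherever `δ x̄ ≠ 0`.
Proof at a.e. `x̄` (★ `ae_exists_mk_eq_discr_ne_zero`: a lift `g` with `disc χ_g ≠ 0`): by ★ (N0) `normalForm_of_discr_ne_zero`, `g` is split, mixed, or
has irreducible `χ_g` — the last is excluded off the elliptic set by ★ `isCompact_centralizer_mk_of_irreducible`; ★ B4-0 `exists_zpow_scalar_mul_integral_of_adBall`
rescales `g` to an INTEGRAL representative `g₁ = ϖ^k g` of the same class (★ `mk_scalar_zpow_mul`) with `ϖ^{h} g₁⁻¹` integral; normal forms rescale (§1);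
`|disc χ_{g₁}| = q^{-L₀} ≤ 1` (§2); ★ `exists_setIntegral_norm_conj_le_of_integral_normalForm` bounds the ball integral by
`M_θ·(c·C(m)·3(2(R+6h+L₀)+1)²·‖2‖⁻¹q^{m+1}·‖disc χ_{g₁}‖^{-1∕2})`; finally `‖disc χ_{g₁}‖ = δ(x̄)·‖det g₁‖²`, `‖det g₁‖ ≥ q^{-3h}` (★ `v_pow_pow_three_le_v_det`)
give `‖disc χ_{g₁}‖^{-1∕2} ≤ q^{3h}·δ(x̄)^{-1∕2}` and `L₀ ≤ 6h + L(x̄)` (§3).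
* §1 `coe_scalar_mul`, `smul_conj`, `smul_leviBlock`, `irreducible_charpoly_smul_block`, `normalForm_smul`; §2 `v_sub_le_one`, `v_discr_charpoly_le_one_of_normalForm`,
  `exists_nat_v_eq_exp_neg`; §3 `inv_sqrt_le_of_eq_mul_sq`, `le_add_of_pow_eq_of_pow_mul_pow_le`; §4 **`ae_setIntegral_norm_conj_le_weight`**.
HONEST LABEL: HC_CM is proved only modulo the 7 printed citations (2 remaining named inputs: hLiu418 = stmt-HodgeConjecture-24832, h413 = stmt-HodgeConjecture-24833) until
rung 0 closes; count-neutral helper, closes no socket.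

## References
* [HarishChandra1970] Harish-Chandra (notes by G. van Dijk), *Harmonic Analysis on Reductive p-adic Groups*, LNM 162 (1970), Part VII §2 Theorem 18 p. 69, §3 pp. 72–73.
-/

set_option autoImplicit false
-- the mandated namespace repeats the single-problem summit's segment (`HodgeConjecture.HodgeConjecture`)
set_option linter.dupNamespace false

noncomputable section

open MeasureTheory Measure Set
open scoped MatrixGroups NNReal ENNReal WithZero
open Literature.NumberTheory.Automorphic Literature.NumberTheory.GaloisRepresentations Literature.NumberTheory.GaloisRepresentations.IsNonarchimedeanLocalField
open Summit.HodgeConjecture.HodgeConjecture.Cruxes.H413.K2E3GL3ModUniformizerNonEllBallMixed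
open Summit.HodgeConjecture.HodgeConjecture.Cruxes.H413.K2E3GL3ModUniformizerNonEllBallSplit
open Summit.HodgeConjecture.HodgeConjecture.Cruxes.H413.K2E3GL3MixedCompanionNormalForm
open Summit.HodgeConjecture.HodgeConjecture.Cruxes.H413.K2E3GL3MixedTorusNormForm
open Summit.HodgeConjecture.HodgeConjecture.Cruxes.H413.K2E3GL3TruncatedCharMixedTorusRadius
open Summit.HodgeConjecture.HodgeConjecture.Cruxes.H413.K2E3GL3TruncatedCharSplitTorusRadius
open Summit.HodgeConjecture.HodgeConjecture.Cruxes.H413.K2E3GLnAdHeightBalls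
open Summit.HodgeConjecture.HodgeConjecture.Cruxes.H413.K2E3GL3ModUniformizerFundamentalDomain
open Summit.HodgeConjecture.HodgeConjecture.Cruxes.H413.K2E3GL3ModUniformizerSeparableAE
open Summit.HodgeConjecture.HodgeConjecture.Cruxes.H413.K2E3GL3ModUniformizerCentralizerCompact
open Summit.HodgeConjecture.HodgeConjecture.Cruxes.H413.K2E3GL3CharpolyDiscNullHaar

namespace Summit.HodgeConjecture.HodgeConjecture.Cruxes.H413.K2E3GL3ModUniformizerNonEllBall

/-! ## §1 Algebra over a field: normal forms rescale -/
section Algebra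

variable {F : Type*} [Field F]

/-- `↑(scalar u · g) = u • ↑g`. [folklore] -/
theorem coe_scalar_mul (u : Fˣ) (g : GL (Fin 3) F) :
    ((Matrix.GeneralLinearGroup.scalar (Fin 3) u * g : GL (Fin 3) F) : Matrix (Fin 3) (Fin 3) F) = (u : F) • (g : Matrix (Fin 3) (Fin 3) F) := by
  rw [Units.val_mul, Matrix.GeneralLinearGroup.coe_scalar, Matrix.scalar_apply, ← Matrix.smul_eq_diagonal_mul]

/-- `u • (↑y · A · ↑y⁻¹) = ↑y · (u • A) · ↑y⁻¹`. [folklore] -/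
theorem smul_conj (u : F) (y : GL (Fin 3) F) (A : Matrix (Fin 3) (Fin 3) F) :
    u • ((y : Matrix (Fin 3) (Fin 3) F) * A * ((y⁻¹ : GL (Fin 3) F) : Matrix (Fin 3) (Fin 3) F)) =
      (y : Matrix (Fin 3) (Fin 3) F) * (u • A) * ((y⁻¹ : GL (Fin 3) F) : Matrix (Fin 3) (Fin 3) F) := by
  rw [Matrix.mul_smul, Matrix.smul_mul]

/-- `u • [[m₀,m₁,0],[m₂,m₃,0],[0,0,m₄]] = [[u m₀,u m₁,0],[u m₂,u m₃,0],[0,0,u m₄]]`. [folklore] -/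
theorem smul_leviBlock (u : F) (m : Fin 5 → F) :
    u • ((!![m 0, m 1, 0; m 2, m 3, 0; 0, 0, m 4] : Matrix (Fin 3) (Fin 3) F)) = !![u * m 0, u * m 1, 0; u * m 2, u * m 3, 0; 0, 0, u * m 4] := by
  ext i j; fin_cases i <;> fin_cases j <;> simp

/-- Irreducibility of the `2 × 2` characteristic polynomial is scale invariant: `χ_{uA}` irreducible if `χ_A` is and `u ≠ 0` (both are rootless monic quadratics;
a root `r` of `χ_{uA}` gives the root `r∕u` of `χ_A`). [folklore] -/
theorem irreducible_charpoly_smul_block {u : F} (hu : u ≠ 0) {m : Fin 5 → F}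
    (hirr : Irreducible ((!![m 0, m 1; m 2, m 3] : Matrix (Fin 2) (Fin 2) F)).charpoly) :
    Irreducible ((!![u * m 0, u * m 1; u * m 2, u * m 3] : Matrix (Fin 2) (Fin 2) F)).charpoly := by
  have hπ : ∀ r : F, r ^ 2 - (m 0 + m 3) * r + (m 0 * m 3 - m 1 * m 2) ≠ 0 :=
    forall_sq_sub_add_ne_zero_of_irreducible (by rw [← charpoly_block_eq m]; exact hirr)
  set M : Matrix (Fin 2) (Fin 2) F := !![u * m 0, u * m 1; u * m 2, u * m 3] with hM
  have hmon : M.charpoly.Monic := Matrix.charpoly_monic M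
  have hdeg : M.charpoly.natDegree = 2 := by rw [Matrix.charpoly_natDegree_eq_dim, Fintype.card_fin]
  rw [hmon.irreducible_iff_roots_eq_zero_of_degree_le_three (by omega) (by omega), Multiset.eq_zero_iff_forall_notMem]
  intro r hr
  rw [Polynomial.mem_roots hmon.ne_zero, Polynomial.IsRoot.def, hM, Matrix.charpoly_fin_two] at hr
  simp only [Matrix.trace_fin_two_of, Matrix.det_fin_two_of, Polynomial.eval_add, Polynomial.eval_sub, Polynomial.eval_mul, Polynomial.eval_pow,
    Polynomial.eval_X, Polynomial.eval_C] at hr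
  refine hπ (r / u) ?_
  have hu2 : u ^ 2 ≠ 0 := pow_ne_zero _ hu
  have : (r / u) ^ 2 - (m 0 + m 3) * (r / u) + (m 0 * m 3 - m 1 * m 2) =
      (r ^ 2 - (u * m 0 + u * m 3) * r + (u * m 0 * (u * m 3) - u * m 1 * (u * m 2))) / u ^ 2 := by
    field_simp
  rw [this, hr, zero_div]

/-- **Normal forms rescale**: if `A` is split (`↑y · diag d · ↑y⁻¹`, `d` injective) or mixed (`↑y · [[m₀,m₁,0],[m₂,m₃,0],[0,0,m₄]] · ↑y⁻¹`, `χ` of the block irreducible)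
then so is `u • A`, `u ≠ 0`. [cite: HarishChandra1970, Part VII §3 p. 72] -/
theorem normalForm_smul {A : Matrix (Fin 3) (Fin 3) F} {u : F} (hu : u ≠ 0)
    (h : (∃ (y : GL (Fin 3) F) (d : Fin 3 → F), Function.Injective d ∧
        A = (y : Matrix (Fin 3) (Fin 3) F) * Matrix.diagonal d * ((y⁻¹ : GL (Fin 3) F) : Matrix (Fin 3) (Fin 3) F)) ∨
      (∃ (y : GL (Fin 3) F) (m : Fin 5 → F), Irreducible ((!![m 0, m 1; m 2, m 3] : Matrix (Fin 2) (Fin 2) F)).charpoly ∧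
        A = (y : Matrix (Fin 3) (Fin 3) F) * !![m 0, m 1, 0; m 2, m 3, 0; 0, 0, m 4] * ((y⁻¹ : GL (Fin 3) F) : Matrix (Fin 3) (Fin 3) F))) :
    (∃ (y : GL (Fin 3) F) (d : Fin 3 → F), Function.Injective d ∧
        u • A = (y : Matrix (Fin 3) (Fin 3) F) * Matrix.diagonal d * ((y⁻¹ : GL (Fin 3) F) : Matrix (Fin 3) (Fin 3) F)) ∨
      (∃ (y : GL (Fin 3) F) (m : Fin 5 → F), Irreducible ((!![m 0, m 1; m 2, m 3] : Matrix (Fin 2) (Fin 2) F)).charpoly ∧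
        u • A = (y : Matrix (Fin 3) (Fin 3) F) * !![m 0, m 1, 0; m 2, m 3, 0; 0, 0, m 4] * ((y⁻¹ : GL (Fin 3) F) : Matrix (Fin 3) (Fin 3) F)) := by
  rcases h with ⟨y, d, hd, hA⟩ | ⟨y, m, hirr, hA⟩
  · refine Or.inl ⟨y, u • d, fun i j hij => hd (mul_left_cancel₀ hu (by simpa using hij)), ?_⟩
    rw [hA, smul_conj, ← Matrix.diagonal_smul]
  · refine Or.inr ⟨y, ![u * m 0, u * m 1, u * m 2, u * m 3, u * m 4], ?_, ?_⟩
    · simpa using irreducible_charpoly_smul_block hu hirr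
    · rw [hA, smul_conj, smul_leviBlock]; simp

end Algebra

/-! ## §2 Valuations: `|disc χ_{g₁}| ≤ 1` at an integral representative in normal form; the depth exponent -/
section Valuations

variable {F : Type*} [Field F] [Valued F ℤᵐ⁰]

/-- `|a|,|b| ≤ 1 ⇒ |a − b| ≤ 1`. [folklore] -/
theorem v_sub_le_one {a b : F} (ha : Valued.v a ≤ 1) (hb : Valued.v b ≤ 1) : Valued.v (a - b) ≤ 1 :=
  (Valuation.map_sub _ a b).trans (max_le ha hb)

/-- **`|disc χ_{g₁}| ≤ 1` for an integral `g₁` in split or mixed normal form** (split: `disc = Δ(d)²` with the eigenvalues `dᵢ` integral, ★ `v_eigenvalue_le_one_of_conj`;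
mixed: `disc = (T² − 4N₀)·π(c₀)²` with `|T|,|N₀|,|c₀| ≤ 1`, ★ `v_T_le_one`∕`v_N_le_one`∕`v_c_le_one`). [cite: HarishChandra1970, Part VII §3 p. 72] -/
theorem v_discr_charpoly_le_one_of_normalForm {g₁ : GL (Fin 3) F}
    (hnf : (∃ (y : GL (Fin 3) F) (d : Fin 3 → F), Function.Injective d ∧
        (g₁ : Matrix (Fin 3) (Fin 3) F) = (y : Matrix (Fin 3) (Fin 3) F) * Matrix.diagonal d * ((y⁻¹ : GL (Fin 3) F) : Matrix (Fin 3) (Fin 3) F)) ∨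
      (∃ (y : GL (Fin 3) F) (m : Fin 5 → F), Irreducible ((!![m 0, m 1; m 2, m 3] : Matrix (Fin 2) (Fin 2) F)).charpoly ∧
        (g₁ : Matrix (Fin 3) (Fin 3) F) = (y : Matrix (Fin 3) (Fin 3) F) * !![m 0, m 1, 0; m 2, m 3, 0; 0, 0, m 4] * ((y⁻¹ : GL (Fin 3) F) : Matrix (Fin 3) (Fin 3) F)))
    (hint : ∀ i j, Valued.v ((g₁ : Matrix (Fin 3) (Fin 3) F) i j) ≤ 1) :
    Valued.v ((g₁ : Matrix (Fin 3) (Fin 3) F)).charpoly.discr ≤ 1 := by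
  rcases hnf with ⟨y, d, -, hg⟩ | ⟨y, e, hirr, hg⟩
  · obtain ⟨hd0, hg'⟩ := exists_glDiagonal_conj_eq hg
    set t : Fin 3 → Fˣ := fun i => Units.mk0 (d i) (hd0 i) with ht
    have hy : ∀ i j, Valued.v ((((y * glDiagonal 3 F t * y⁻¹ : GL (Fin 3) F)) : Matrix (Fin 3) (Fin 3) F) i j) ≤ 1 := by rw [← hg']; exact hint
    have ht1 : ∀ i, Valued.v (d i) ≤ 1 := fun i => v_eigenvalue_le_one_of_conj (coe_glDiagonal 3 F t) hy i
    have hdisc : ((g₁ : Matrix (Fin 3) (Fin 3) F)).charpoly.discr = ((d 0 - d 1) * (d 0 - d 2) * (d 1 - d 2)) ^ 2 := by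
      rw [hg, Matrix.coe_units_inv, Matrix.charpoly_units_conj, K2E3SplitTorusDepthFromDiscriminant.charpoly_discr_diagonal_fin_three]; ring
    rw [hdisc, map_pow, map_mul, map_mul]
    exact pow_le_one₀ zero_le (mul_le_one' (mul_le_one' (v_sub_le_one (ht1 0) (ht1 1)) (v_sub_le_one (ht1 0) (ht1 2))) (v_sub_le_one (ht1 1) (ht1 2)))
  · obtain ⟨y₂, hy₂⟩ := exists_leviBlock_eq_conj_companion e hirr
    have hg' : (g₁ : Matrix (Fin 3) (Fin 3) F) = ((y * y₂ : GL (Fin 3) F) : Matrix (Fin 3) (Fin 3) F) *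
        !![0, -(e 0 * e 3 - e 1 * e 2), 0; 1, e 0 + e 3, 0; 0, 0, e 4] * (((y * y₂)⁻¹ : GL (Fin 3) F) : Matrix (Fin 3) (Fin 3) F) := by
      rw [hg, hy₂, mul_inv_rev, Units.val_mul, Units.val_mul]
      simp only [Matrix.mul_assoc]
    obtain ⟨γ, hγ, hg₁⟩ := exists_conj_eq_of_coe hg'
    have hy : ∀ i j, Valued.v (((((y * y₂) * γ * (y * y₂)⁻¹ : GL (Fin 3) F)) : Matrix (Fin 3) (Fin 3) F) i j) ≤ 1 := by rw [← hg₁]; exact hint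
    have hT1 := v_T_le_one hγ hy
    have hN1 := v_N_le_one hγ hy
    have hc1 := v_c_le_one hγ hy
    have hdisc : ((g₁ : Matrix (Fin 3) (Fin 3) F)).charpoly.discr =
        ((e 0 + e 3) ^ 2 - 4 * (e 0 * e 3 - e 1 * e 2)) * (e 4 ^ 2 - (e 0 + e 3) * e 4 + (e 0 * e 3 - e 1 * e 2)) ^ 2 := by
      rw [hg, Matrix.coe_units_inv, Matrix.charpoly_units_conj, discr_charpoly_leviBlock]
    rw [hdisc, map_mul, map_pow]
    refine mul_le_one' (v_discr_le_one hT1 hN1) (pow_le_one₀ zero_le ?_)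
    refine (Valuation.map_add _ _ _).trans (max_le (v_sub_le_one ?_ ?_) hN1)
    · rw [map_pow]; exact pow_le_one₀ zero_le hc1
    · rw [map_mul]; exact mul_le_one' hT1 hc1

/-- A nonzero integral element has valuation `exp(−L)` for a natural number `L`. [folklore] -/
theorem exists_nat_v_eq_exp_neg {x : F} (hx : x ≠ 0) (h1 : Valued.v x ≤ 1) : ∃ L : ℕ, Valued.v x = WithZero.exp (-(L : ℤ)) := by
  have hv0 : Valued.v x ≠ 0 := (Valuation.ne_zero_iff _).2 hx
  have hexp : Valued.v x = WithZero.exp (WithZero.log (Valued.v x)) := (WithZero.exp_log hv0).symm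
  have hle : WithZero.log (Valued.v x) ≤ 0 := by
    rw [hexp, ← WithZero.exp_zero, WithZero.exp_le_exp] at h1; exact h1
  refine ⟨(-WithZero.log (Valued.v x)).toNat, ?_⟩
  rw [Int.toNat_of_nonneg (neg_nonneg.2 hle), neg_neg]; exact hexp

end Valuations

/-! ## §3 `ℝ≥0` bookkeeping: from the representative to the class -/
section Weights

/-- `D = δ·a²`, `r ≤ a`, `δ, r ≠ 0` ⇒ `(√D)⁻¹ ≤ r⁻¹·(√δ)⁻¹`. [folklore] -/
theorem inv_sqrt_le_of_eq_mul_sq {D δ a r : ℝ≥0} (hD : D = δ * a ^ 2) (hr : r ≤ a) (hδ0 : δ ≠ 0) (hr0 : r ≠ 0) :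
    (NNReal.sqrt D)⁻¹ ≤ r⁻¹ * (NNReal.sqrt δ)⁻¹ := by
  rw [hD, NNReal.sqrt_mul, NNReal.sqrt_sq, ← mul_inv, mul_comm r]
  have hpos : 0 < NNReal.sqrt δ * r := mul_pos (NNReal.sqrt_pos.2 (pos_iff_ne_zero.2 hδ0)) (pos_iff_ne_zero.2 hr0)
  exact inv_anti₀ hpos (mul_le_mul_of_nonneg_left hr bot_le)

/-- `s^{L₀} = δ·a²` with `s^{L} ≤ δ`, `s^{k} ≤ a`, `0 < s < 1` ⇒ `L₀ ≤ L + 2k`. [folklore] -/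
theorem le_add_of_pow_eq_of_pow_mul_pow_le {s δ a : ℝ≥0} (hs0 : 0 < s) (hs1 : s < 1) {L₀ L k : ℕ}
    (hD : s ^ L₀ = δ * a ^ 2) (hL : s ^ L ≤ δ) (hk : s ^ k ≤ a) : L₀ ≤ L + 2 * k := by
  have h : s ^ (L + 2 * k) ≤ s ^ L₀ := by
    rw [hD, pow_add, pow_mul']
    exact mul_le_mul' hL (pow_le_pow_left' hk 2)
  exact (pow_le_pow_iff_right_of_lt_one₀ hs0 hs1).1 h

end Weights

/-! ## §4 `hball`, packaged -/

variable {F : Type*} [Field F] [Valued F ℤᵐ⁰] [ValuativeRel F] [(Valued.v : Valuation F ℤᵐ⁰).Compatible] [IsNonarchimedeanLocalField F]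
  [MeasurableSpace (GL (Fin 3) F)] [BorelSpace (GL (Fin 3) F)]
  {ϖ : F} (hϖ : Valued.v ϖ = WithZero.exp (-1 : ℤ)) (hϖ0 : ϖ ≠ 0)
  [((Subgroup.zpowers (Units.mk0 ϖ hϖ0)).map (Matrix.GeneralLinearGroup.scalar (Fin 3))).Normal]
  [MeasurableSpace (GL (Fin 3) F ⧸ (Subgroup.zpowers (Units.mk0 ϖ hϖ0)).map (Matrix.GeneralLinearGroup.scalar (Fin 3)))]
  [BorelSpace (GL (Fin 3) F ⧸ (Subgroup.zpowers (Units.mk0 ϖ hϖ0)).map (Matrix.GeneralLinearGroup.scalar (Fin 3)))]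
  (μ' : Measure (GL (Fin 3) F ⧸ (Subgroup.zpowers (Units.mk0 ϖ hϖ0)).map (Matrix.GeneralLinearGroup.scalar (Fin 3)))) [μ'.IsHaarMeasure]

include hϖ in
/-- **`hball` PACKAGED (Haar-a.e. on `G'`, off the elliptic set).**  There are `c : ℝ≥0` and `C : ℕ → ℝ≥0∞` finite such that for every `θ : G' → E` bounded by `M_θ` and
vanishing off `Ω m`, every height `h` (`x̄ ∈ Ω (h x̄)`), every `δ` with `δ(mk g) = ‖disc χ_g‖ ∕ ‖det g‖²`, every depth `L` with `q^{-L x̄} ≤ δ x̄` where `δ x̄ ≠ 0`,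
and every radius `R : G' → ℕ`: for `μ'`-a.e. `x̄` with NON-compact centralizer,
`∫_{Ω (R x̄)} ‖θ(z · x̄ · z⁻¹)‖ dμ'(z) ≤ M_θ · (c · (C m · 3(2(R x̄ + (12 h x̄ + L x̄))+1)² · (‖2‖⁻¹ q^{m+1} · ((q^{3 h x̄}) · δ(x̄)^{-1∕2})))).toReal`.
[cite: HarishChandra1970, Part VII §2 Theorem 18 p. 69; §3 pp. 72–73] -/
theorem ae_setIntegral_norm_conj_le_weight {E : Type*} [NormedAddCommGroup E] (h2 : (2 : F) ≠ 0)
    (Ω : ℕ → Set (GL (Fin 3) F ⧸ (Subgroup.zpowers (Units.mk0 ϖ hϖ0)).map (Matrix.GeneralLinearGroup.scalar (Fin 3))))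
    (hmem : ∀ (n : ℕ) (z : GL (Fin 3) F),
      (QuotientGroup.mk z : GL (Fin 3) F ⧸ (Subgroup.zpowers (Units.mk0 ϖ hϖ0)).map (Matrix.GeneralLinearGroup.scalar (Fin 3))) ∈ Ω n ↔
        ∀ i j k l, Valued.v (ϖ ^ n * ((z : Matrix (Fin 3) (Fin 3) F) i j * ((z⁻¹ : GL (Fin 3) F) : Matrix (Fin 3) (Fin 3) F) k l)) ≤ 1) :
    ∃ (c : ℝ≥0) (C : ℕ → ℝ≥0∞), (∀ m, C m ≠ ⊤) ∧
      ∀ (θ : GL (Fin 3) F ⧸ (Subgroup.zpowers (Units.mk0 ϖ hϖ0)).map (Matrix.GeneralLinearGroup.scalar (Fin 3)) → E) (Mθ : ℝ) (m : ℕ),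
        (∀ x, ‖θ x‖ ≤ Mθ) → (∀ x, x ∉ Ω m → θ x = 0) →
        ∀ (hgt : GL (Fin 3) F ⧸ (Subgroup.zpowers (Units.mk0 ϖ hϖ0)).map (Matrix.GeneralLinearGroup.scalar (Fin 3)) → ℕ)
          (δ : GL (Fin 3) F ⧸ (Subgroup.zpowers (Units.mk0 ϖ hϖ0)).map (Matrix.GeneralLinearGroup.scalar (Fin 3)) → ℝ≥0)
          (L R : GL (Fin 3) F ⧸ (Subgroup.zpowers (Units.mk0 ϖ hϖ0)).map (Matrix.GeneralLinearGroup.scalar (Fin 3)) → ℕ),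
          (∀ x, x ∈ Ω (hgt x)) →
          (∀ g : GL (Fin 3) F, δ (QuotientGroup.mk g) =
              normAbs F ((g : Matrix (Fin 3) (Fin 3) F)).charpoly.discr / normAbs F ((g : Matrix (Fin 3) (Fin 3) F)).det ^ 2) →
          (∀ x, δ x ≠ 0 → ((residueFieldCard F : ℝ≥0)⁻¹) ^ (L x) ≤ δ x) →
          ∀ᵐ x ∂μ', ¬ IsCompact ((Subgroup.centralizer {x} :
                Subgroup (GL (Fin 3) F ⧸ (Subgroup.zpowers (Units.mk0 ϖ hϖ0)).map (Matrix.GeneralLinearGroup.scalar (Fin 3)))) :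
              Set (GL (Fin 3) F ⧸ (Subgroup.zpowers (Units.mk0 ϖ hϖ0)).map (Matrix.GeneralLinearGroup.scalar (Fin 3)))) →
            ∫ z in Ω (R x), ‖θ (z * x * z⁻¹)‖ ∂μ' ≤
              Mθ * ((c : ℝ≥0∞) * (C m * ((3 * (2 * (R x + (12 * hgt x + L x)) + 1) ^ 2 : ℕ) : ℝ≥0∞) *
                ((normAbs F (2 : F))⁻¹ * (residueFieldCard F : ℝ≥0) ^ (m + 1) *
                  ((residueFieldCard F : ℝ≥0) ^ (3 * hgt x) * (NNReal.sqrt (δ x))⁻¹) : ℝ≥0))).toReal := by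
  obtain ⟨c, C, hC, hmain⟩ := exists_setIntegral_norm_conj_le_of_integral_normalForm (E := E) hϖ hϖ0 μ' h2 Ω hmem
  refine ⟨c, C, hC, fun θ Mθ m hM hsupp hgt δ L R hhgt hδ hL => ?_⟩
  have hMθ : 0 ≤ Mθ := (norm_nonneg _).trans (hM 1)
  filter_upwards [ae_exists_mk_eq_discr_ne_zero hϖ hϖ0 μ'] with x hx hnc
  obtain ⟨g, rfl, hD⟩ := hx
  -- the height and the integral representative `g₁ = ϖ^k g`
  set h : ℕ := hgt (QuotientGroup.mk g) with hhdef
  have hball : ∀ i j k l, Valued.v (ϖ ^ h * ((g : Matrix (Fin 3) (Fin 3) F) i j * ((g⁻¹ : GL (Fin 3) F) : Matrix (Fin 3) (Fin 3) F) k l)) ≤ 1 :=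
    (hmem h g).1 (hhgt _)
  obtain ⟨k, hint, hinv⟩ := exists_zpow_scalar_mul_integral_of_adBall hϖ hϖ0 hball
  set g₁ : GL (Fin 3) F := Matrix.GeneralLinearGroup.scalar (Fin 3) (Units.mk0 ϖ hϖ0 ^ k) * g with hg₁def
  have hmk : (QuotientGroup.mk g₁ : GL (Fin 3) F ⧸ (Subgroup.zpowers (Units.mk0 ϖ hϖ0)).map (Matrix.GeneralLinearGroup.scalar (Fin 3))) =
      QuotientGroup.mk g := mk_scalar_zpow_mul hϖ0 k g
  have hu : ((Units.mk0 ϖ hϖ0 ^ k : Fˣ) : F) ≠ 0 := (Units.mk0 ϖ hϖ0 ^ k).ne_zero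
  have hcoe : (g₁ : Matrix (Fin 3) (Fin 3) F) = ((Units.mk0 ϖ hϖ0 ^ k : Fˣ) : F) • (g : Matrix (Fin 3) (Fin 3) F) := coe_scalar_mul _ _
  -- normal form of `g` (off the elliptic set) and of `g₁`
  have hnf₁ : (∃ (y : GL (Fin 3) F) (d : Fin 3 → F), Function.Injective d ∧
        (g₁ : Matrix (Fin 3) (Fin 3) F) = (y : Matrix (Fin 3) (Fin 3) F) * Matrix.diagonal d * ((y⁻¹ : GL (Fin 3) F) : Matrix (Fin 3) (Fin 3) F)) ∨
      (∃ (y : GL (Fin 3) F) (m : Fin 5 → F), Irreducible ((!![m 0, m 1; m 2, m 3] : Matrix (Fin 2) (Fin 2) F)).charpoly ∧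
        (g₁ : Matrix (Fin 3) (Fin 3) F) =
          (y : Matrix (Fin 3) (Fin 3) F) * !![m 0, m 1, 0; m 2, m 3, 0; 0, 0, m 4] * ((y⁻¹ : GL (Fin 3) F) : Matrix (Fin 3) (Fin 3) F)) := by
    rw [hcoe]
    refine normalForm_smul hu ?_
    rcases normalForm_of_discr_ne_zero _ hD with h' | h' | h'
    · exact Or.inl h'
    · exact Or.inr h'
    · exact absurd (isCompact_centralizer_mk_of_irreducible hϖ hϖ0 g h') hnc
  -- `δ x̄ = ‖disc χ_{g₁}‖ ∕ ‖det g₁‖²`, nonzero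
  have hdet0 : ((g₁ : Matrix (Fin 3) (Fin 3) F)).det ≠ 0 := ((Matrix.isUnit_iff_isUnit_det _).1 (Units.isUnit g₁)).ne_zero
  have hdetg0 : ((g : Matrix (Fin 3) (Fin 3) F)).det ≠ 0 := ((Matrix.isUnit_iff_isUnit_det _).1 (Units.isUnit g)).ne_zero
  have hδx : δ (QuotientGroup.mk g) = normAbs F ((g₁ : Matrix (Fin 3) (Fin 3) F)).charpoly.discr / normAbs F ((g₁ : Matrix (Fin 3) (Fin 3) F)).det ^ 2 := by
    rw [← hmk]; exact hδ g₁
  have hδ0 : δ (QuotientGroup.mk g) ≠ 0 := by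
    rw [hδ g]
    exact div_ne_zero ((_root_.map_ne_zero _).2 hD) (pow_ne_zero _ ((_root_.map_ne_zero _).2 hdetg0))
  have ha0 : normAbs F ((g₁ : Matrix (Fin 3) (Fin 3) F)).det ≠ 0 := (_root_.map_ne_zero _).2 hdet0
  have hDeq : normAbs F ((g₁ : Matrix (Fin 3) (Fin 3) F)).charpoly.discr = δ (QuotientGroup.mk g) * normAbs F ((g₁ : Matrix (Fin 3) (Fin 3) F)).det ^ 2 := by
    rw [hδx, div_mul_cancel₀ _ (pow_ne_zero _ ha0)]
  have hdisc0 : ((g₁ : Matrix (Fin 3) (Fin 3) F)).charpoly.discr ≠ 0 := by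
    intro h0; apply hδ0; rw [hδx, h0, map_zero, zero_div]
  -- the depth exponent `L₀` of the representative
  obtain ⟨L₀, hL₀⟩ := exists_nat_v_eq_exp_neg hdisc0 (v_discr_charpoly_le_one_of_normalForm hnf₁ hint)
  -- the bound at the representative
  have key := hmain θ Mθ m hM hsupp g₁ h L₀ (R (QuotientGroup.mk g)) hnf₁ hint hinv hL₀
  rw [hmk] at key
  -- `‖ϖ‖ = q⁻¹`, `q^{-3h} ≤ ‖det g₁‖`, `‖disc χ_{g₁}‖ = q^{-L₀}`
  have hq : normAbs F ϖ = (residueFieldCard F : ℝ≥0)⁻¹ := normAbs_uniformizer_eq_inv hϖ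
  have hs0 : (0 : ℝ≥0) < (residueFieldCard F : ℝ≥0)⁻¹ := inv_residueFieldCard_pos
  have hs1 : (residueFieldCard F : ℝ≥0)⁻¹ < 1 := inv_residueFieldCard_lt_one
  have hdet : ((residueFieldCard F : ℝ≥0)⁻¹) ^ (3 * h) ≤ normAbs F ((g₁ : Matrix (Fin 3) (Fin 3) F)).det := by
    have hv := v_pow_pow_three_le_v_det (y := g₁) hinv
    have hn : normAbs F ((ϖ ^ h) ^ 3) ≤ normAbs F ((g₁ : Matrix (Fin 3) (Fin 3) F)).det :=
      normAbs_le_normAbs_iff.2 ((v_le_iff_valuation_le _ _).1 hv)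
    rwa [map_pow, map_pow, hq, ← pow_mul, mul_comm] at hn
  have hDL : ((residueFieldCard F : ℝ≥0)⁻¹) ^ L₀ = normAbs F ((g₁ : Matrix (Fin 3) (Fin 3) F)).charpoly.discr := by
    have hϖL : Valued.v (ϖ ^ L₀) = WithZero.exp (-(L₀ : ℤ)) := by
      rw [map_pow, hϖ, ← WithZero.exp_nsmul]; congr 1; simp
    have hv : Valued.v ((g₁ : Matrix (Fin 3) (Fin 3) F)).charpoly.discr = Valued.v (ϖ ^ L₀) := by rw [hL₀, hϖL]
    have h1 := normAbs_le_normAbs_iff.2 ((v_le_iff_valuation_le _ _).1 hv.le)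
    have h2' := normAbs_le_normAbs_iff.2 ((v_le_iff_valuation_le _ _).1 hv.ge)
    rw [map_pow, hq] at h1 h2'
    exact le_antisymm h2' h1
  -- compare exponents and weights
  have hLle : L₀ ≤ L (QuotientGroup.mk g) + 2 * (3 * h) :=
    le_add_of_pow_eq_of_pow_mul_pow_le hs0 hs1 (hDL.trans hDeq) (hL _ hδ0) hdet
  refine le_toReal_bound_mono hMθ le_rfl le_rfl (hC m) ?_ ?_ key
  · exact Nat.mul_le_mul_left 3 (Nat.pow_le_pow_left (by omega) 2)
  · refine mul_le_mul_of_nonneg_left ?_ bot_le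
    have hr0 : ((residueFieldCard F : ℝ≥0)⁻¹) ^ (3 * h) ≠ 0 := pow_ne_zero _ hs0.ne'
    have := inv_sqrt_le_of_eq_mul_sq hDeq hdet hδ0 hr0
    rwa [inv_pow, inv_inv] at this

end Summit.HodgeConjecture.HodgeConjecture.Cruxes.H413.K2E3GL3ModUniformizerNonEllBall

end
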